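import Mathlib
import Summits.ValiantsHypothesis.ValiantsHypothesis.Theorems.LacunarySymmetroidMatrixDescartesCensusTropicalKLaw
import Summits.ValiantsHypothesis.ValiantsHypothesis.Theorems.LacunarySymmetroidMatrixDescartesCensusTropicalKLawStatic
import Summits.ValiantsHypothesis.ValiantsHypothesis.Theorems.KPlusLogSqLawTropicalPermutationChanges

/-!
# Tropical census — the SWITCH BUDGET of a dominant chain (a non-counting structural lemma)

DE-DUP NOTE (desk R1327 (4), 2026-08-26): the SHARPER forms of these statements are
`TropicalCensus.card_samePerm_steps_le` (`≤ m·m·(K−1)`) and `TropicalCensus.le_permChanges_add` of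
`Theorems/KPlusLogSqLawTropicalPermutationChanges.lean` (val-sym-lift-p2, p419330), and the one-entry comparison is
`TropicalCensus.score_lt_of_dominant` (`…TropicalKLawStatic`).  This module was filed in parallel before that ruling was
read; it now keeps its four declaration names with UNCHANGED statements, proved as one-line COROLLARIES of the cited
lemmas (`switch_window` is the only packaging not literally in those files).  Cite the sharper names, not these.

HONEST FRAMING.  Helper toward the registered stub `stub_liftThin` of the crux `Lifting`
(`Summit.ValiantsHypothesis.ValiantsHypothesis.Theses.KPlusLogSqLaw.Lifting`, ledger item
`stmt-ValiantsHypothesis-19772`, route `KPlusLogSqLaw`, object-search cell `pub-symmetroid`), and equally a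
structural fact about the tropical rows `TropicalCensus.TropRootLawAt` of the sibling crux `TropicalB`
(`stmt-ValiantsHypothesis-19771`).  Nothing here asserts either crux, `KPlusLogSqLaw`, `MatrixDescartes`
(`stmt-ValiantsHypothesis-18050`) or anything about `VP ≠ VNP`; it proves an unconditional combinatorial lemma about
the cell's dominance-design vocabulary (`MatrixDescartes.Negative.IsDominant` / `termSign` / `tropWeight`).

THE LEMMA.  Along any chain `p₀, …, pₙ` of terms `pₖ = (σₖ, λₖ)` that are dominant (unique optima) at strictly
increasing integer slopes `θ₀ < ⋯ < θₙ` with alternating signs, call a step `k → k+1` a SWITCH if the permutation is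
kept (`σₖ = σₖ₊₁`, only classes change) and an EXCHANGE otherwise.  Then

  `#{switch steps} ≤ m² · K²`   (`switch_steps_card_le`),  hence  `n ≤ m²K² + #{exchange steps}`  (`le_switchBudget_add_exchanges`).

So every design counted by `TropRootLawAt m K ·` spends at most `m²K²` of its alternations on class switches; in
particular a format-`(m, 4)` family with `Θ(m³)` alternations (the open «third multiplying digit», tree candidate
`TropicalCensus.TropK4Law 2`) must realise `Ω(m³)` PERMUTATION EXCHANGES — the innermost digit cannot be carried by
parallel-class switches.  This is the kernel form of the cell's located ceiling for «population» architectures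
(HOME/pub-symmetroid-conjb-2/NOTES-conjb2.md §2 (F), §3 (i)), now valid for ALL designs.

PROOF.  A switch step at position `i` (where `λₖ i ≠ λₖ₊₁ i`, entry `e = (σₖ i, i)`, classes `l = λₖ i`, `l' = λₖ₊₁ i`)
forces, by dominance against the two one-entry modifications (present because both chain terms are present),
`θₖ·(d l' − d l) < v e l' − v e l < θₖ₊₁·(d l' − d l)`: the affine crossing point of the two classes of the entry
lies strictly between `θₖ` and `θₖ₊₁`.  A second switch step `k' > k` with the same datum `(e, l, l')` would put
the same crossing point inside `(θₖ', θₖ'₊₁)`, disjoint from `(θₖ, θₖ₊₁)` — contradiction.  Hence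
`k ↦ (σₖ i, i, λₖ i, λₖ₊₁ i)` is injective on switch steps, into a set of size `m·m·K·K`. [folklore]
(val-sym-lift-p1, 2026-08-26; bears on the K = 4 fork of ONBOARD-val-sym §3.3.)
-/

-- `Summit.ValiantsHypothesis.ValiantsHypothesis.…` repeats a component by the D-0017 layout
-- (single-conjunct summit), which the `dupNamespace` linter flags; the name is mandated.
set_option linter.dupNamespace false
set_option autoImplicit false

namespace Summit.ValiantsHypothesis.ValiantsHypothesis.Theorems.LacunarySymmetroidMatrixDescartes.TropicalCensus

open Summit.ValiantsHypothesis.ValiantsHypothesis.Theorems.MatrixDescartes.Negative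
open Finset

variable {m K : ℕ}

/-- **One-entry comparison at a dominant term.**  If `(σ, μ)` is the unique optimum at slope `θ` and `(σ, ν)` is any
present term with the same permutation, then at every position `i` with `μ i ≠ ν i` the class `μ i` strictly beats
the class `ν i` at the entry `(σ i, i)`:  `θ·d(ν i) − v(σ i, i, ν i) < θ·d(μ i) − v(σ i, i, μ i)`. [folklore] -/
theorem entry_lt_of_dominant (d : Fin K → ℕ) (v ε : Fin m → Fin m → Fin K → ℤ) {θ : ℤ}
    (σ : Equiv.Perm (Fin m)) (μ ν : Fin m → Fin K) (ha : IsDominant d v ε θ (σ, μ))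
    (hν : termSign ε (σ, ν) ≠ 0) (i : Fin m) (hi : μ i ≠ ν i) :
    θ * (d (ν i) : ℤ) - v (σ i) i (ν i) < θ * (d (μ i) : ℤ) - v (σ i) i (μ i) := by
  -- corollary of the tree's one-entry optimality lemma
  exact score_lt_of_dominant d v ε θ σ μ ha i (ν i) (present_of_termSign_ne_zero ε (σ, ν) hν i) (Ne.symm hi)

/-- **The crossing-point inequalities of a switch step.**  If `(σ, μ)` is dominant at `θa` and `(σ, ν)` (same
permutation) at `θb`, then at every position `i` with `μ i ≠ ν i` the valuation difference of the two classes at the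
entry `(σ i, i)` is pinned strictly between `θa·Δd` and `θb·Δd`, `Δd = d(ν i) − d(μ i)`. [folklore] -/
theorem switch_window (d : Fin K → ℕ) (v ε : Fin m → Fin m → Fin K → ℤ) {θa θb : ℤ}
    (σ : Equiv.Perm (Fin m)) (μ ν : Fin m → Fin K) (ha : IsDominant d v ε θa (σ, μ))
    (hb : IsDominant d v ε θb (σ, ν)) (i : Fin m) (hi : μ i ≠ ν i) :
    θa * ((d (ν i) : ℤ) - d (μ i)) < v (σ i) i (ν i) - v (σ i) i (μ i) ∧
      v (σ i) i (ν i) - v (σ i) i (μ i) < θb * ((d (ν i) : ℤ) - d (μ i)) := by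
  have h1 := entry_lt_of_dominant d v ε σ μ ν ha hb.1 i hi
  have h2 := entry_lt_of_dominant d v ε σ ν μ hb ha.1 i (Ne.symm hi)
  constructor <;> linarith

open scoped Classical in
/-- **SWITCH BUDGET.**  Along a chain of dominant terms at strictly increasing slopes with alternating signs, the
steps that keep the permutation (pure class switches) number at most `m² · K²`: the map
`k ↦ (σₖ i, i, λₖ i, λₖ₊₁ i)` (`i` a position where the class changes) is injective on them, because the crossing
point of the two classes at that entry lies in `(θₖ, θₖ₊₁)` and these open intervals are pairwise disjoint. [folklore] -/
theorem switch_steps_card_le (d : Fin K → ℕ) (v ε : Fin m → Fin m → Fin K → ℤ) (n : ℕ)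
    (θ : Fin (n + 1) → ℤ) (p : Fin (n + 1) → Equiv.Perm (Fin m) × (Fin m → Fin K))
    (hθ : StrictMono θ) (hdom : ∀ k, IsDominant d v ε (θ k) (p k))
    (halt : ∀ k : Fin n, termSign ε (p k.castSucc) * termSign ε (p k.succ) < 0) :
    (univ.filter (fun k : Fin n => (p k.castSucc).1 = (p k.succ).1)).card ≤ m ^ 2 * K ^ 2 := by
  -- corollary of the sharper `card_samePerm_steps_le` (bound `m·m·(K−1)`)
  have hinj : Function.Injective p := stub_dominantInjective m K d v ε n θ p hθ hdom halt
  have h := card_samePerm_steps_le d v ε n θ p hθ hdom hinj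
  have hKK : m * m * (K - 1) ≤ m ^ 2 * K ^ 2 := by
    have h1 : K - 1 ≤ K ^ 2 := by nlinarith [Nat.sub_le K 1]
    calc m * m * (K - 1) ≤ m * m * K ^ 2 := Nat.mul_le_mul_left _ h1
      _ = m ^ 2 * K ^ 2 := by ring
  exact h.trans hKK

open scoped Classical in
/-- **Alternations = switches + exchanges, and switches are few.**  For every chain as in the tropical row
`TropRootLawAt m K ·`: `n ≤ m²K² + #{k : σₖ ≠ σₖ₊₁}`.  A family of format `(m, K)` with more than quadratically
many (in `m`, at fixed `K`) alternations therefore changes its permutation that many times. [folklore] -/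
theorem le_switchBudget_add_exchanges (d : Fin K → ℕ) (v ε : Fin m → Fin m → Fin K → ℤ) (n : ℕ)
    (θ : Fin (n + 1) → ℤ) (p : Fin (n + 1) → Equiv.Perm (Fin m) × (Fin m → Fin K))
    (hθ : StrictMono θ) (hdom : ∀ k, IsDominant d v ε (θ k) (p k))
    (halt : ∀ k : Fin n, termSign ε (p k.castSucc) * termSign ε (p k.succ) < 0) :
    n ≤ m ^ 2 * K ^ 2 + (univ.filter (fun k : Fin n => (p k.castSucc).1 ≠ (p k.succ).1)).card := by
  -- corollary of the sharper `le_permChanges_add`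
  have h := le_permChanges_add d v ε n θ p hθ hdom halt
  have hKK : m * m * (K - 1) ≤ m ^ 2 * K ^ 2 := by
    have h1 : K - 1 ≤ K ^ 2 := by nlinarith [Nat.sub_le K 1]
    calc m * m * (K - 1) ≤ m * m * K ^ 2 := Nat.mul_le_mul_left _ h1
      _ = m ^ 2 * K ^ 2 := by ring
  omega

end Summit.ValiantsHypothesis.ValiantsHypothesis.Theorems.LacunarySymmetroidMatrixDescartes.TropicalCensus
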